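import Summits.AtomisticToContinuum.BoseEinsteinCondensation.Theses.BECTangentRigidity
import Summits.AtomisticToContinuum.BoseEinsteinCondensation.Theses.BECDyadicChaining
import Summits.AtomisticToContinuum.BoseEinsteinCondensation.Theorems.BECTangentRigidityTangentTransferStubFloorSharp
import Summits.AtomisticToContinuum.BoseEinsteinCondensation.Theorems.BECTangentRigidityTangentTransferStubNoClumping
import Summits.AtomisticToContinuum.BoseEinsteinCondensation.Theorems.BECTangentRigidityTangentTransferStubFreeCoarse
import Summits.AtomisticToContinuum.BoseEinsteinCondensation.Theorems.BECTangentRigidityTangentTransferStubBaseAmplitude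
import Summits.AtomisticToContinuum.BoseEinsteinCondensation.Theorems.BECTangentRigidityTangentTransferStubChainBookkeeping
import Summits.AtomisticToContinuum.BoseEinsteinCondensation.Theorems.BECDyadicChainingCoherentAmplitudeMonotone
import Literature.MathematicalPhysics.QuantumManyBody.DyadicCoherentFractionRefinement
import Literature.MathematicalPhysics.QuantumManyBody.BoseGasMergeOccupation
import HarnessLib

/-!
# Crux `BECTangentRigidity.TangentTransfer` (stmt-AtomisticToContinuum-13033) from the open crux
# `BECDyadicChaining.DyadicCoherenceDefect` (stmt-AtomisticToContinuum-13192) — CONDITIONAL reduction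

Line `registered` of the crux `TangentTransfer` (lead `prover-line-stmt-AtomisticToContinuum-13033-c2-0`,
skeleton v3 = `Cruxes/TangentTransfer/Lines/birth.lean`): every stub of the line except the one that IS item
13192 has landed (`stub_mesoscopicFloorPinned` p149155, `stub_floorSharp` p151645, `stub_noClumping` p153432,
`stub_freeCoarse` p154246, `stub_baseAmplitude` p154671, `stub_chainBookkeeping` p155532, with Literature
support `BoseGasSubcellCondensation{,Dilute,Sharp}.lean`, `BoseGasSubcellNoClumping.lean`).  This file records
the resulting reduction as theorems:

* `coarse_zero_of_pos` — for `a(v) > 0`: 13192's clause for `v` (one summable budget `β`, `Σβ ≤ 1/4`, bounding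
  the per-level coherent-amplitude increments above a scale `ℓ_d(v)`) + the sharp mesoscopic floor
  `(1-η)N` at the scale `M/√ρ` (`stub_floorSharp`, LSSY Lemma 5.2 / 4.1 mechanism) + no clumping of the flat
  cell modes (`stub_noClumping`, cell-method convexity) + the algebraic base amplitude bound
  (`stub_baseAmplitude`) + the chain bookkeeping (`stub_chainBookkeeping`) give `cohSum_0 ≥ N/2` for all
  near-minimisers, eventually in `N`, at all small `ρ` (`η = 1/100`, `M = max 1 ℓ_d`, `0.98/√1.01 ≥ 24/25`);
* `coarse_zero_of_dyadicCoherenceDefect` — all `v` (`a(v) = 0` by `stub_freeCoarse`: free Dirichlet gas,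
  `F_0 = (8/π²)³ > 1/2`);
* `coarseCoherence_of_dyadicCoherenceDefect : DyadicCoherenceDefect → CoarseCoherence` (route target 13032 with
  `K = 0`) and `tangentTransfer_of_dyadicCoherenceDefect : DyadicCoherenceDefect → TangentTransfer` (crux 13033;
  its hypotheses `MesoscopicFloor(v)` and `RigidMomentumBound(v)` are not used).

CONDITIONAL: nothing here closes 13033 or 13032 — the open content of both routes BECTangentRigidity and
BECDyadicChaining is the single item 13192 (summable dyadic coherence defect of the thermodynamic Dirichlet
ground state above an `N`-independent scale = BEC in the thermodynamic limit in scale-resolved form).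
No new definitions; axioms `propext`, `Classical.choice`, `Quot.sound`.
-/

noncomputable section

open MeasureTheory Filter Set
open scoped ENNReal NNReal Topology BigOperators

namespace Summit.AtomisticToContinuum.BoseEinsteinCondensation.Cruxes.TangentTransfer.Birth

open Literature.MathematicalPhysics.QuantumManyBody.BoseGas
open Summit.AtomisticToContinuum.BoseEinsteinCondensation.Theses.BECTangentRigidity (TangentTransfer)
open Summit.AtomisticToContinuum.BoseEinsteinCondensation.Theses.BECDyadicChaining (DyadicCoherenceDefect)

/-! ## Helpers for the composition (sorry-free) -/

/-- The numerical margin of the base: `24/25 ≤ (1 - 2/100)/√(1 + 1/100)`. -/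
theorem base_constant_le : (24 / 25 : ℝ) ≤ (1 - 2 * (1 / 100)) / Real.sqrt (1 + 1 / 100) := by
  rw [le_div_iff₀ (Real.sqrt_pos.2 (by norm_num))]
  have h : Real.sqrt (1 + 1 / 100) ≤ 201 / 200 := by
    rw [Real.sqrt_le_left (by norm_num)]
    norm_num
  nlinarith

/-- Open dyadic cubes have the same flat-mode occupation as the half-open cells (they agree a.e.). -/
theorem occupation_openCube_eq_dyMode (N : ℕ) (L : ℝ) (Ψ : Config N → ℂ) (k : ℕ)
    (i : Fin 3 → Fin (2 ^ k)) :
    occupation N (Set.indicator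
        {x : EuclideanSpace ℝ (Fin 3) | ∀ j : Fin 3, x j ∈ Set.Ioo (((i j : ℕ) : ℝ) * (L / 2 ^ k))
          ((((i j : ℕ) : ℝ) + 1) * (L / 2 ^ k))}
        (fun _ => ((Real.sqrt ((L / 2 ^ k) ^ 3))⁻¹ : ℂ))) Ψ = occupation N (dyMode L k i) Ψ :=
  occupation_congr_ae (indicator_ae_eq_of_ae_eq_set
    (Theorems.CoherentAmplitudeMonotone.openCell_ae_eq_dyCell L k i)) Ψ

/-- **Coarse coherence at level `0`, positive scattering length** — the heart of the v2 composition at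
fixed `v`: 13192's clause for `v` + sharp floor + no clumping + base amplitude + chain bookkeeping. -/
theorem coarse_zero_of_pos {v : ℝ → ℝ≥0∞} (hv : IsRepulsiveFiniteRange v)
    (hFl : ∀ η : ℝ, 0 < η → η < 1 → ∀ M : ℝ, 1 ≤ M →
      ∃ ρ₀ : ℝ, 0 < ρ₀ ∧ ∀ ρ : ℝ, 0 < ρ → ρ < ρ₀ →
        ∀ᶠ N : ℕ in atTop, ∃ δ : ℝ≥0∞, 0 < δ ∧ ∀ Ψ : TrialState N (sideLength ρ N),
          energy v Ψ ≤ groundStateEnergy v N (sideLength ρ N) + δ →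
          ∀ k : ℕ, M / Real.sqrt ρ ≤ sideLength ρ N / 2 ^ k →
            sideLength ρ N / 2 ^ k < 2 * (M / Real.sqrt ρ) →
            ENNReal.ofReal ((1 - η) * N) ≤ cohSum N (sideLength ρ N) k Ψ.ψ)
    (hNc : ∀ η : ℝ, 0 < η → η < 1 → ∀ M : ℝ, 1 ≤ M →
      ∃ ρ₀ : ℝ, 0 < ρ₀ ∧ ∀ ρ : ℝ, 0 < ρ → ρ < ρ₀ →
        ∀ᶠ N : ℕ in atTop, ∃ δ : ℝ≥0∞, 0 < δ ∧ ∀ Ψ : TrialState N (sideLength ρ N),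
          energy v Ψ ≤ groundStateEnergy v N (sideLength ρ N) + δ →
          ∀ k : ℕ, M / Real.sqrt ρ ≤ sideLength ρ N / 2 ^ k →
            sideLength ρ N / 2 ^ k < 2 * (M / Real.sqrt ρ) →
            ∑ m : Fin 3 → Fin (2 ^ k),
                (occupation N (dyMode (sideLength ρ N) k m) Ψ.ψ -
                  ENNReal.ofReal ((1 + η) * N / 8 ^ k)) ≤ ENNReal.ofReal (η * N))
    (hBa : ∀ (N : ℕ) (L : ℝ) (k : ℕ) (Ψ : Config N → ℂ) (η : ℝ), 0 < η →
      ENNReal.ofReal ((1 - η) * N) ≤ cohSum N L k Ψ →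
      ∑ m : Fin 3 → Fin (2 ^ k),
          (occupation N (dyMode L k m) Ψ - ENNReal.ofReal ((1 + η) * N / 8 ^ k)) ≤
        ENNReal.ofReal (η * N) →
      ENNReal.ofReal ((1 - 2 * η) / Real.sqrt (1 + η)) * (N : ℝ≥0∞) ^ (1 / 2 : ℝ) ≤
        (8 : ℝ≥0∞) ^ (-(k : ℝ) / 2) *
          ∑ m : Fin 3 → Fin (2 ^ k), (occupation N (dyMode L k m) Ψ) ^ (1 / 2 : ℝ))
    (hCh : ∀ (N : ℕ) (L : ℝ) (Ψ : Config N → ℂ) (ℓd : ℝ), 0 < ℓd → 0 < L →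
      ∀ β : ℕ → ℝ, (∀ j, 0 ≤ β j) → Summable β → ∑' j, β j ≤ 1 / 4 →
      let A : ℕ → ℝ≥0∞ := fun m => (8 : ℝ≥0∞) ^ (-(m : ℝ) / 2) *
        ∑ i : Fin 3 → Fin (2 ^ m), (occupation N (dyMode L m i) Ψ) ^ (1 / 2 : ℝ)
      (∀ m j : ℕ, 1 ≤ m → ℓd * 2 ^ j ≤ L / 2 ^ m → L / 2 ^ m < ℓd * 2 ^ (j + 1) →
        A m ≤ A (m - 1) + ENNReal.ofReal (β j) * (N : ℝ≥0∞) ^ (1 / 2 : ℝ)) →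
      ∀ n : ℕ, ℓd ≤ L / 2 ^ n →
        ENNReal.ofReal (24 / 25) * (N : ℝ≥0∞) ^ (1 / 2 : ℝ) ≤ A n →
        ENNReal.ofReal ((N : ℝ) / 2) ≤ cohSum N L 0 Ψ)
    (hD : DyadicCoherenceDefect) :
    ∃ ρ₀ : ℝ, 0 < ρ₀ ∧ ∀ ρ : ℝ, 0 < ρ → ρ < ρ₀ →
      ∀ᶠ N : ℕ in atTop, ∃ δ : ℝ≥0∞, 0 < δ ∧ ∀ Ψ : TrialState N (sideLength ρ N),
        energy v Ψ ≤ groundStateEnergy v N (sideLength ρ N) + δ →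
          ENNReal.ofReal ((N : ℝ) / 2) ≤ cohSum N (sideLength ρ N) 0 Ψ.ψ := by
  obtain ⟨ℓd, hℓd, ρ₁, hρ₁, H4⟩ := hD v hv
  have hη : (0 : ℝ) < 1 / 100 := by norm_num
  have hη1 : (1 / 100 : ℝ) < 1 := by norm_num
  set M : ℝ := max 1 ℓd with hM
  have hM1 : 1 ≤ M := le_max_left _ _
  have hMℓ : ℓd ≤ M := le_max_right _ _
  have hMpos : 0 < M := lt_of_lt_of_le one_pos hM1
  obtain ⟨ρ₂, hρ₂, H1⟩ := hFl (1 / 100) hη hη1 M hM1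
  obtain ⟨ρ₃, hρ₃, H2⟩ := hNc (1 / 100) hη hη1 M hM1
  refine ⟨min (min ρ₁ (min ρ₂ ρ₃)) 1, lt_min (lt_min hρ₁ (lt_min hρ₂ hρ₃)) one_pos,
    fun ρ hρ hρlt => ?_⟩
  have hρ1 : ρ < ρ₁ := hρlt.trans_le ((min_le_left _ _).trans (min_le_left _ _))
  have hρ2 : ρ < ρ₂ :=
    hρlt.trans_le ((min_le_left _ _).trans ((min_le_right _ _).trans (min_le_left _ _)))
  have hρ3 : ρ < ρ₃ :=
    hρlt.trans_le ((min_le_left _ _).trans ((min_le_right _ _).trans (min_le_right _ _)))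
  have hρone : ρ < 1 := hρlt.trans_le (min_le_right _ _)
  obtain ⟨β, hβ0, hβs, hβ4, E4⟩ := H4 ρ hρ hρ1
  have E1 := H1 ρ hρ hρ2
  have E2 := H2 ρ hρ hρ3
  -- the floor scale `ℓ = M/√ρ ≥ ℓ_d`
  set ℓ : ℝ := M / Real.sqrt ρ with hℓ
  have hsρ : 0 < Real.sqrt ρ := Real.sqrt_pos.2 hρ
  have hℓpos : 0 < ℓ := div_pos hMpos hsρ
  have hℓdℓ : ℓd ≤ ℓ := by
    rw [hℓ, le_div_iff₀ hsρ]
    calc ℓd * Real.sqrt ρ ≤ ℓd * 1 :=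
          mul_le_mul_of_nonneg_left (Real.sqrt_le_one.mpr hρone.le) hℓd.le
      _ ≤ M := by rw [mul_one]; exact hMℓ
  have hLev : ∀ᶠ N : ℕ in atTop, ℓ ≤ sideLength ρ N :=
    (tendsto_sideLength_atTop hρ).eventually_ge_atTop ℓ
  filter_upwards [E1, E2, E4, hLev] with N hN1 hN2 hN4 hLN
  obtain ⟨δ₁, hδ₁, h1⟩ := hN1
  obtain ⟨δ₂, hδ₂, h2⟩ := hN2
  obtain ⟨δ₄, hδ₄, h4⟩ := hN4
  refine ⟨min δ₁ (min δ₂ δ₄), lt_min hδ₁ (lt_min hδ₂ hδ₄), fun Ψ hΨ => ?_⟩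
  have hLpos : 0 < sideLength ρ N := lt_of_lt_of_le hℓpos hLN
  -- the floor level `n`: `ℓ ≤ L/2^n < 2ℓ`
  have hx : 1 ≤ sideLength ρ N / ℓ := by rwa [le_div_iff₀ hℓpos, one_mul]
  obtain ⟨n, hn1, hn2⟩ := exists_nat_pow_near hx one_lt_two
  have hk1 : ℓ ≤ sideLength ρ N / 2 ^ n := by
    rw [le_div_iff₀ (by positivity)]
    have := (le_div_iff₀ hℓpos).1 hn1
    linarith
  have hk2 : sideLength ρ N / 2 ^ n < 2 * ℓ := by
    rw [div_lt_iff₀ (by positivity)]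
    have := (div_lt_iff₀ hℓpos).1 hn2
    rw [pow_succ] at this
    linarith
  have hΨ1 : energy v Ψ ≤ groundStateEnergy v N (sideLength ρ N) + δ₁ :=
    hΨ.trans (add_le_add le_rfl (min_le_left _ _))
  have hΨ2 : energy v Ψ ≤ groundStateEnergy v N (sideLength ρ N) + δ₂ :=
    hΨ.trans (add_le_add le_rfl ((min_le_right _ _).trans (min_le_left _ _)))
  have hΨ4 : energy v Ψ ≤ groundStateEnergy v N (sideLength ρ N) + δ₄ :=
    hΨ.trans (add_le_add le_rfl ((min_le_right _ _).trans (min_le_right _ _)))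
  -- floor, no clumping, base amplitude at level `n`
  have hfloor := h1 Ψ hΨ1 n hk1 hk2
  have hclump := h2 Ψ hΨ2 n hk1 hk2
  have hbase := hBa N (sideLength ρ N) n Ψ.ψ (1 / 100) hη hfloor hclump
  have hbase' : ENNReal.ofReal (24 / 25) * (N : ℝ≥0∞) ^ (1 / 2 : ℝ) ≤
      (8 : ℝ≥0∞) ^ (-(n : ℝ) / 2) *
        ∑ m : Fin 3 → Fin (2 ^ n), (occupation N (dyMode (sideLength ρ N) n m) Ψ.ψ) ^ (1 / 2 : ℝ) :=
    (mul_le_mul_left (ENNReal.ofReal_le_ofReal base_constant_le) _).trans hbase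
  -- 13192's clause for `Ψ`, over the half-open cells
  have h4Ψ := h4 Ψ hΨ4
  simp only [occupation_openCube_eq_dyMode] at h4Ψ
  -- chain bookkeeping
  refine hCh N (sideLength ρ N) Ψ.ψ ℓd hℓd hLpos β hβ0 hβs hβ4 ?_ n (hℓdℓ.trans hk1) hbase'
  intro m j hm hj1 hj2
  exact h4Ψ m j hm hj1 hj2

/-! ## The reduction of the crux (and of the route target) to item 13192 -/

/-- **Coarse coherence at level `0` from `DyadicCoherenceDefect`**, for every admissible `v`: the case split on
the scattering length, with the five landed stubs plugged into `coarse_zero_of_pos` / `stub_freeCoarse`. -/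
theorem coarse_zero_of_dyadicCoherenceDefect (hD : DyadicCoherenceDefect) {v : ℝ → ℝ≥0∞}
    (hv : IsRepulsiveFiniteRange v) :
    ∃ ρ₀ : ℝ, 0 < ρ₀ ∧ ∀ ρ : ℝ, 0 < ρ → ρ < ρ₀ →
      ∀ᶠ N : ℕ in atTop, ∃ δ : ℝ≥0∞, 0 < δ ∧ ∀ Ψ : TrialState N (sideLength ρ N),
        energy v Ψ ≤ groundStateEnergy v N (sideLength ρ N) + δ →
          ENNReal.ofReal ((N : ℝ) / 2) ≤ cohSum N (sideLength ρ N) 0 Ψ.ψ := by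
  rcases eq_or_ne (scatteringLength v) 0 with h0 | hne
  · exact ⟨1, one_pos, fun ρ hρ _ => stub_freeCoarse v hv h0 ρ hρ⟩
  · exact coarse_zero_of_pos hv (stub_floorSharp v hv (pos_iff_ne_zero.2 hne))
      (stub_noClumping v hv (pos_iff_ne_zero.2 hne)) stub_baseAmplitude stub_chainBookkeeping hD

end Summit.AtomisticToContinuum.BoseEinsteinCondensation.Cruxes.TangentTransfer.Birth

namespace Summit.AtomisticToContinuum.BoseEinsteinCondensation.Theorems

open Literature.MathematicalPhysics.QuantumManyBody.BoseGas
open Summit.AtomisticToContinuum.BoseEinsteinCondensation.Theses.BECTangentRigidity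
  (TangentTransfer CoarseCoherence)
open Summit.AtomisticToContinuum.BoseEinsteinCondensation.Theses.BECDyadicChaining (DyadicCoherenceDefect)
open Summit.AtomisticToContinuum.BoseEinsteinCondensation.Cruxes.TangentTransfer.Birth

/-- **The route target modulo 13192.** `BECDyadicChaining.DyadicCoherenceDefect` (item
stmt-AtomisticToContinuum-13192) implies `BECTangentRigidity.CoarseCoherence` (item 13032) — with the coarse
level `K = 0` (the constant mode of the box carries at least half of the particles of every near-minimiser,
for every repulsive finite-range `v` at all small densities).  CONDITIONAL on the open item 13192 only. -/
theorem coarseCoherence_of_dyadicCoherenceDefect (hD : DyadicCoherenceDefect) : CoarseCoherence := by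
  intro v hv
  obtain ⟨ρ₀, hρ₀, H⟩ := coarse_zero_of_dyadicCoherenceDefect hD hv
  exact ⟨ρ₀, hρ₀, fun ρ hρ hρlt => ⟨0, H ρ hρ hρlt⟩⟩

/-- **The crux modulo 13192.** `BECDyadicChaining.DyadicCoherenceDefect` (item stmt-AtomisticToContinuum-13192)
implies `BECTangentRigidity.TangentTransfer` (item stmt-AtomisticToContinuum-13033); both hypotheses of the
crux (`MesoscopicFloor(v)`, `RigidMomentumBound(v)`) are idle.  CONDITIONAL on the open item 13192 only: this
theorem does NOT close 13033; it records that the line `registered` (skeleton v3,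
`Cruxes/TangentTransfer/Lines/birth.lean`) is closed modulo exactly that item. -/
theorem tangentTransfer_of_dyadicCoherenceDefect (hD : DyadicCoherenceDefect) : TangentTransfer :=
  fun v hv _ _ => coarseCoherence_of_dyadicCoherenceDefect hD v hv

end Summit.AtomisticToContinuum.BoseEinsteinCondensation.Theorems

end
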